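import Mathlib

/-!
# Second-order expansion of a quadratic phase under a sum of changes (stub `stub_flipPhase`)

The stub `stub_flipPhase` (a staged component of `stub_rankCore`) of the crux
`MobiusLadder.QuadraticDigitPhases` (stmt-QuantumAdvantage-1391), line `Sketch`.

For the quadratic phase `Φ(z) = Σ_{i<j<N} a i j · zᵢ zⱼ + Σ_{i<N} lᵢ zᵢ` over `𝔽₂` and changes
`δ t` (`t < m`),
`Φ(y + Σ_t δ_t) = Φ(y) + Σ_t (Φ(y + δ_t) − Φ(y)) + Σ_{t<t'} B(δ_t, δ_{t'})`
with the polar form `B(u, v) = Σ_{i<j} a i j (uᵢ vⱼ + uⱼ vᵢ)`.  This is a pure commutative-ring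
identity (no characteristic assumption): we prove it for an arbitrary coefficient function
`a : ℕ → ℕ → R` over any commutative ring `R` (`expansion_general`) by expanding the products,
distributing the sums and splitting the square double sum over `range m × range m` into its
diagonal and its symmetrised strictly upper triangular part (`sum_range_sq_split`); the stub is the
special case `R = ZMod 2` with the coefficient function `fun i j => if i < j then a i j else 0`.
Elementary (folklore); Mathlib only.
-/

set_option linter.dupNamespace false -- D-0017: single-problem summit ⇒ QuantumAdvantage.QuantumAdvantage by design

namespace Summit.QuantumAdvantage.QuantumAdvantage.Theorems.MobiusLadderQuadraticDigitPhasesStubFlipPhase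

open Finset

/-- Moving the outermost of three nested finite sums innermost. [folklore] -/
theorem sum_comm_right {α β γ M : Type*} [AddCommMonoid M] (s : Finset α) (t : Finset β)
    (u : Finset γ) (f : α → β → γ → M) :
    ∑ x ∈ s, ∑ y ∈ t, ∑ z ∈ u, f x y z = ∑ y ∈ t, ∑ z ∈ u, ∑ x ∈ s, f x y z := by
  rw [Finset.sum_comm]
  exact Finset.sum_congr rfl fun y _ => Finset.sum_comm

/-- Moving the two outermost of four nested finite sums innermost. [folklore] -/
theorem sum_comm_four {α β γ κ M : Type*} [AddCommMonoid M] (s : Finset α) (t : Finset β)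
    (u : Finset γ) (v : Finset κ) (f : α → β → γ → κ → M) :
    ∑ x ∈ s, ∑ y ∈ t, ∑ z ∈ u, ∑ w ∈ v, f x y z w =
      ∑ z ∈ u, ∑ w ∈ v, ∑ x ∈ s, ∑ y ∈ t, f x y z w := by
  calc ∑ x ∈ s, ∑ y ∈ t, ∑ z ∈ u, ∑ w ∈ v, f x y z w
      = ∑ x ∈ s, ∑ z ∈ u, ∑ w ∈ v, ∑ y ∈ t, f x y z w :=
        Finset.sum_congr rfl fun x _ => sum_comm_right t u v (f x)
    _ = ∑ z ∈ u, ∑ w ∈ v, ∑ x ∈ s, ∑ y ∈ t, f x y z w :=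
        sum_comm_right s u v fun x z w => ∑ y ∈ t, f x y z w

/-- Splitting a square double sum over `range m × range m` into its diagonal and its symmetrised
strictly upper triangular part. [folklore] -/
theorem sum_range_sq_split {M : Type*} [AddCommMonoid M] (F : ℕ → ℕ → M) (m : ℕ) :
    ∑ t ∈ range m, ∑ t' ∈ range m, F t t' =
      ∑ t ∈ range m, F t t +
        ∑ t ∈ range m, ∑ t' ∈ range m, (if t < t' then F t t' + F t' t else 0) := by
  induction m with
  | zero => simp
  | succ m ih =>
    have h1 : ∀ t ∈ range m, (if t < m then F t m + F m t else 0) = F t m + F m t :=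
      fun t ht => if_pos (mem_range.mp ht)
    have h2 : ∀ t' ∈ range m, (if m < t' then F m t' + F t' m else 0) = 0 :=
      fun t' ht' => if_neg fun h => lt_asymm h (mem_range.mp ht')
    simp only [sum_range_succ, lt_self_iff_false, if_false, add_zero, sum_add_distrib]
    rw [sum_congr rfl h1, sum_eq_zero h2, ih, sum_add_distrib, add_zero]
    abel

/-- The second-order expansion of the quadratic phase `Φ(z) = Σᵢ Σⱼ a i j · zᵢ zⱼ + Σᵢ lᵢ zᵢ`
(indices below `N`, arbitrary coefficients over a commutative ring) under a sum of `m` changes: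
`Φ(y + Σ_t δ_t) = Φ(y) + Σ_t (Φ(y + δ_t) − Φ(y)) + Σ_{t<t'} B(δ_t, δ_{t'})` with the polar form
`B(u, v) = Σᵢ Σⱼ a i j (uᵢ vⱼ + uⱼ vᵢ)`. [folklore] -/
theorem expansion_general {R : Type*} [CommRing R] (N m : ℕ) (a : ℕ → ℕ → R) (l : ℕ → R)
    (y : ℕ → R) (δ : ℕ → ℕ → R) :
    (∑ i ∈ range N, ∑ j ∈ range N,
          a i j * (y i + ∑ t ∈ range m, δ t i) * (y j + ∑ t ∈ range m, δ t j)
        + ∑ i ∈ range N, l i * (y i + ∑ t ∈ range m, δ t i)) =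
      (∑ i ∈ range N, ∑ j ∈ range N, a i j * y i * y j + ∑ i ∈ range N, l i * y i)
        + ∑ t ∈ range m, ((∑ i ∈ range N, ∑ j ∈ range N,
              a i j * (y i + δ t i) * (y j + δ t j) + ∑ i ∈ range N, l i * (y i + δ t i))
            - (∑ i ∈ range N, ∑ j ∈ range N, a i j * y i * y j + ∑ i ∈ range N, l i * y i))
        + ∑ t ∈ range m, ∑ t' ∈ range m, (if t < t' then
            ∑ i ∈ range N, ∑ j ∈ range N, a i j * (δ t i * δ t' j + δ t j * δ t' i) else 0) := by
  -- the four bilinear expansions of the left-hand side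
  have P1 : ∑ i ∈ range N, ∑ j ∈ range N, a i j * y i * (∑ t ∈ range m, δ t j) =
      ∑ t ∈ range m, ∑ i ∈ range N, ∑ j ∈ range N, a i j * y i * δ t j := by
    rw [sum_comm_right (range m) (range N) (range N)]
    exact sum_congr rfl fun i _ => sum_congr rfl fun j _ => by rw [mul_sum]
  have P2 : ∑ i ∈ range N, ∑ j ∈ range N, a i j * (∑ t ∈ range m, δ t i) * y j =
      ∑ t ∈ range m, ∑ i ∈ range N, ∑ j ∈ range N, a i j * δ t i * y j := by
    rw [sum_comm_right (range m) (range N) (range N)]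
    exact sum_congr rfl fun i _ => sum_congr rfl fun j _ => by rw [mul_sum, sum_mul]
  have P3 : ∑ i ∈ range N, ∑ j ∈ range N,
        a i j * (∑ t ∈ range m, δ t i) * (∑ t ∈ range m, δ t j) =
      ∑ t ∈ range m, ∑ t' ∈ range m, ∑ i ∈ range N, ∑ j ∈ range N,
        a i j * δ t i * δ t' j := by
    rw [sum_comm_four (range m) (range m) (range N) (range N)]
    exact sum_congr rfl fun i _ => sum_congr rfl fun j _ => by rw [mul_sum (a := a i j), sum_mul_sum]
  have P4 : ∑ i ∈ range N, l i * (∑ t ∈ range m, δ t i) =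
      ∑ t ∈ range m, ∑ i ∈ range N, l i * δ t i := by
    rw [Finset.sum_comm]
    exact sum_congr rfl fun i _ => by rw [mul_sum]
  -- expansion of the left-hand side
  have h1 : (∑ i ∈ range N, ∑ j ∈ range N,
          a i j * (y i + ∑ t ∈ range m, δ t i) * (y j + ∑ t ∈ range m, δ t j)
        + ∑ i ∈ range N, l i * (y i + ∑ t ∈ range m, δ t i)) =
      ∑ i ∈ range N, ∑ j ∈ range N, a i j * y i * y j
        + ∑ t ∈ range m, ∑ i ∈ range N, ∑ j ∈ range N, a i j * y i * δ t j
        + ∑ t ∈ range m, ∑ i ∈ range N, ∑ j ∈ range N, a i j * δ t i * y j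
        + ∑ t ∈ range m, ∑ t' ∈ range m, ∑ i ∈ range N, ∑ j ∈ range N,
            a i j * δ t i * δ t' j
        + (∑ i ∈ range N, l i * y i + ∑ t ∈ range m, ∑ i ∈ range N, l i * δ t i) := by
    have e1 : ∀ i j, a i j * (y i + ∑ t ∈ range m, δ t i) * (y j + ∑ t ∈ range m, δ t j) =
        a i j * y i * y j + (a i j * y i * (∑ t ∈ range m, δ t j)
          + a i j * (∑ t ∈ range m, δ t i) * y j
          + a i j * (∑ t ∈ range m, δ t i) * (∑ t ∈ range m, δ t j)) := fun i j => by ring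
    have e1' : ∀ i, l i * (y i + ∑ t ∈ range m, δ t i) =
        l i * y i + l i * (∑ t ∈ range m, δ t i) := fun i => by ring
    rw [← P1, ← P2, ← P3, ← P4]
    simp only [e1, e1', sum_add_distrib]
    abel
  -- expansion of the first-order differences
  have h2 : ∀ t, (∑ i ∈ range N, ∑ j ∈ range N,
          a i j * (y i + δ t i) * (y j + δ t j) + ∑ i ∈ range N, l i * (y i + δ t i))
        - (∑ i ∈ range N, ∑ j ∈ range N, a i j * y i * y j + ∑ i ∈ range N, l i * y i) =
      ∑ i ∈ range N, ∑ j ∈ range N, a i j * y i * δ t j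
        + ∑ i ∈ range N, ∑ j ∈ range N, a i j * δ t i * y j
        + ∑ i ∈ range N, ∑ j ∈ range N, a i j * δ t i * δ t j
        + ∑ i ∈ range N, l i * δ t i := by
    intro t
    have e2 : ∀ i j, a i j * (y i + δ t i) * (y j + δ t j) =
        a i j * y i * y j + (a i j * y i * δ t j + a i j * δ t i * y j
          + a i j * δ t i * δ t j) := fun i j => by ring
    have e2' : ∀ i, l i * (y i + δ t i) = l i * y i + l i * δ t i := fun i => by ring
    simp only [e2, e2', sum_add_distrib]
    abel
  have h2sum : ∑ t ∈ range m, ((∑ i ∈ range N, ∑ j ∈ range N,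
          a i j * (y i + δ t i) * (y j + δ t j) + ∑ i ∈ range N, l i * (y i + δ t i))
        - (∑ i ∈ range N, ∑ j ∈ range N, a i j * y i * y j + ∑ i ∈ range N, l i * y i)) =
      ∑ t ∈ range m, ∑ i ∈ range N, ∑ j ∈ range N, a i j * y i * δ t j
        + ∑ t ∈ range m, ∑ i ∈ range N, ∑ j ∈ range N, a i j * δ t i * y j
        + ∑ t ∈ range m, ∑ i ∈ range N, ∑ j ∈ range N, a i j * δ t i * δ t j
        + ∑ t ∈ range m, ∑ i ∈ range N, l i * δ t i := by
    simp only [h2, sum_add_distrib]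
  -- the square double sum: diagonal plus symmetrised upper triangle
  have h3 : ∑ t ∈ range m, ∑ t' ∈ range m, ∑ i ∈ range N, ∑ j ∈ range N,
        a i j * δ t i * δ t' j =
      ∑ t ∈ range m, ∑ i ∈ range N, ∑ j ∈ range N, a i j * δ t i * δ t j
        + ∑ t ∈ range m, ∑ t' ∈ range m, (if t < t' then
            ∑ i ∈ range N, ∑ j ∈ range N, a i j * δ t i * δ t' j
              + ∑ i ∈ range N, ∑ j ∈ range N, a i j * δ t' i * δ t j else 0) :=
    sum_range_sq_split (fun t t' => ∑ i ∈ range N, ∑ j ∈ range N, a i j * δ t i * δ t' j) m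
  -- the polar form
  have h4 : ∀ t t', ∑ i ∈ range N, ∑ j ∈ range N, a i j * (δ t i * δ t' j + δ t j * δ t' i) =
      ∑ i ∈ range N, ∑ j ∈ range N, a i j * δ t i * δ t' j
        + ∑ i ∈ range N, ∑ j ∈ range N, a i j * δ t' i * δ t j := by
    intro t t'
    rw [← sum_add_distrib]
    refine sum_congr rfl fun i _ => ?_
    rw [← sum_add_distrib]
    refine sum_congr rfl fun j _ => ?_
    ring
  have h5 : ∑ t ∈ range m, ∑ t' ∈ range m, (if t < t' then
        ∑ i ∈ range N, ∑ j ∈ range N, a i j * (δ t i * δ t' j + δ t j * δ t' i) else 0) =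
      ∑ t ∈ range m, ∑ t' ∈ range m, (if t < t' then
        ∑ i ∈ range N, ∑ j ∈ range N, a i j * δ t i * δ t' j
          + ∑ i ∈ range N, ∑ j ∈ range N, a i j * δ t' i * δ t j else 0) := by
    simp only [h4]
  linear_combination h1 - h2sum - h5 + h3

/-- **Stub `stub_flipPhase`** (second-order expansion): for the quadratic phase
`Φ(z) = Σ_{i<j<N} a i j · zᵢ zⱼ + Σ_{i<N} lᵢ zᵢ` over `𝔽₂` and changes `δ t` (`t < m`),
`Φ(y + Σ_t δ_t) = Φ(y) + Σ_t (Φ(y + δ_t) − Φ(y)) + Σ_{t<t'} B(δ_t, δ_{t'})` with the polar form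
`B(u, v) = Σ_{i<j} a i j (uᵢ vⱼ + uⱼ vᵢ)`; the special case of `expansion_general` with the
coefficient function `fun i j => if i < j then a i j else 0`. [folklore] -/
theorem stub_flipPhase :
    ∀ (N m : ℕ) (a : ℕ → ℕ → ZMod 2) (l : ℕ → ZMod 2) (y : ℕ → ZMod 2) (δ : ℕ → ℕ → ZMod 2),
      (∑ i ∈ Finset.range N, ∑ j ∈ Finset.range N, (if i < j then a i j * (y i + ∑ t ∈ Finset.range m, δ t i) * (y j + ∑ t ∈ Finset.range m, δ t j) else 0)
          + ∑ i ∈ Finset.range N, l i * (y i + ∑ t ∈ Finset.range m, δ t i)) =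
      (∑ i ∈ Finset.range N, ∑ j ∈ Finset.range N, (if i < j then a i j * y i * y j else 0) + ∑ i ∈ Finset.range N, l i * y i)
        + ∑ t ∈ Finset.range m, ((∑ i ∈ Finset.range N, ∑ j ∈ Finset.range N, (if i < j then a i j * (y i + δ t i) * (y j + δ t j) else 0) + ∑ i ∈ Finset.range N, l i * (y i + δ t i))
            - (∑ i ∈ Finset.range N, ∑ j ∈ Finset.range N, (if i < j then a i j * y i * y j else 0) + ∑ i ∈ Finset.range N, l i * y i))
        + ∑ t ∈ Finset.range m, ∑ t' ∈ Finset.range m, (if t < t' then ∑ i ∈ Finset.range N, ∑ j ∈ Finset.range N, (if i < j then a i j * (δ t i * δ t' j + δ t j * δ t' i) else 0) else 0) := by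
  intro N m a l y δ
  have h := expansion_general N m (fun i j => if i < j then a i j else 0) l y δ
  simp only [ite_mul, zero_mul] at h
  exact h

end Summit.QuantumAdvantage.QuantumAdvantage.Theorems.MobiusLadderQuadraticDigitPhasesStubFlipPhase
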